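import Mathlib
import Summits.RiemannHypothesis.RiemannHypothesis.Theorems.HandoffRealZeroCount
import Summits.RiemannHypothesis.RiemannHypothesis.Theorems.HandoffXiZeroCount
import Summits.RiemannHypothesis.RiemannHypothesis.Theorems.HandoffCountThinReal
import Literature.NumberTheory.LFunctions.RiemannXiProofs
import Literature.NumberTheory.LFunctions.ZetaZerosProofs
import Literature.NumberTheory.LFunctions.ZetaRealAxis
import Literature.NumberTheory.LFunctions.WeilGroundState
import Literature.NumberTheory.LFunctions.WeilExplicitProofs
import Literature.NumberTheory.LFunctions.WeilExplicitDirichletConj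
import Literature.Analysis.Complex.FourierPolyaKiKimEngine
import HarnessLib

/-!
# ROUTE R-K «COUNT-AND-THIN», open-neighbourhood form; «RH up to height T»; the ground-state instance

Handoff track (ROUTE 1′), prove-1 gen13; companion of `HandoffCountThin.lean` (G22-T, idea-3 gen22
ROUTE R-K TASK H-K1; HOME/handoff/IDEAS-finite-rank.md v3.3.1 §G22-3/§G22-4), routed through the
real-axis form `HandoffCountThinReal` so that it imports built modules only.

* `im_eq_zero_of_count_of_nhds` — ONE WINDOW, open-neighbourhood form: `û_t` entire and real on `ℝ`,
  real normalisers `c_t ≠ 0` with `c_t û_t → Ξ` locally uniformly on an open `U ⊇ [0, T]`, and SC-2 at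
  `T` (eventually `#{x ∈ (0,T] : û_t(x) = 0} = N(T)`) ⟹ no non-real zero of `Ξ` with `0 < Re z ≤ T`.
  (Weierstrass `RealZeroCount.tendstoUniformlyOn_re_iteratedDeriv` + the real-axis theorem
  `im_eq_zero_of_count_of_smoothConvergence`.) Evenness is not needed in this form.
* `riemannHypothesisInStripUpTo_of_count_of_nhds` — the same conclusion as the tree's
  `RiemannHypothesisInStripUpTo T` («RH up to height T»; certified for `T ≤ 3·10¹²`): per window the
  pair SC-2 ∧ SC-3 is numerical RH, its content is the uniformity in `T`.
* `riemannHypothesis_of_frequently_count_of_nhds` — SC-2 at unboundedly many `T` + convergence near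
  every real segment ⟹ `RiemannHypothesis`.
* `exists_nhds_of_even_thinRect` — idea-3's thin rectangle `[0, T+1] × [-δ, δ]` plus evenness gives
  such a neighbourhood; hence `riemannHypothesis_of_frequently_count_of_thin`.
* `riemannHypothesis_of_groundStates_count_thin` — the intended instance: REAL EVEN Weil ground states
  `IsWeilGroundState (a t) (u t)`, `û_t(z) = 𝓜u_t(1/2 + iz)` (real on `ℝ` and even by
  `conj_weilMellin_of_selfAdjoint` / `weilMellin_conj`; under Connes's (M1) the ground state is real
  and even up to a phase), SC-2 ∧ SC-3 ⟹ RH.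
Pure implications; SC-2/SC-3 for the ground states are idea-3's open conjectures; nothing here is,
or suggests, a proof of RH.
-/

set_option linter.dupNamespace false  -- the mandated namespace repeats `RiemannHypothesis`

noncomputable section

open Filter Set Topology Metric Complex
open scoped BigOperators ComplexConjugate
open Literature.NumberTheory.LFunctions Literature.Analysis.Complex.KiKim

namespace Summit.RiemannHypothesis.RiemannHypothesis.Theorems

namespace CountThin

open RealZeroCount

/-! ## One window, open-neighbourhood form -/

/-- **One window, open-neighbourhood form.** Let `û_t = F t` be entire and real on `ℝ`, `c_t ≠ 0`
real normalisers with `c_t û_t → Ξ` locally uniformly on an open set `U ⊇ [0, T]` (`T > 0`), and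
assume SC-2 at `T`: eventually `#{x ∈ (0, T] : û_t(x) = 0} = N(T)`. Then every zero of `Ξ` with
`0 < Re z ≤ T` is real. -/
theorem im_eq_zero_of_count_of_nhds {F : ℝ → ℂ → ℂ} (hdiff : ∀ t, Differentiable ℂ (F t))
    (hreal : ∀ (t : ℝ) (x : ℝ), (F t x).im = 0) {c : ℝ → ℝ} (hc : ∀ t, c t ≠ 0)
    {T : ℝ} {U : Set ℂ} (hUo : IsOpen U) (hseg : ∀ x ∈ Icc (0 : ℝ) T, (x : ℂ) ∈ U)
    (hC : ∀ᶠ t : ℝ in atTop,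
      {x : ℝ | 0 < x ∧ x ≤ T ∧ F t x = 0}.encard = (zetaZeroCount T : ℕ∞))
    (hloc : TendstoLocallyUniformlyOn (fun t z => ((c t : ℝ) : ℂ) * F t z) riemannXiUpper atTop U) :
    ∀ z : ℂ, riemannXiUpper z = 0 → 0 < z.re → z.re ≤ T → z.im = 0 := by
  set Φ : ℝ → ℂ → ℂ := fun t z => ((c t : ℝ) : ℂ) * F t z with hΦ
  have hΦd : ∀ t, Differentiable ℂ (Φ t) := fun t => (differentiable_const _).mul (hdiff t)
  set g : ℝ → ℝ → ℝ := fun t x => (Φ t x).re with hg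
  refine im_eq_zero_of_count_of_smoothConvergence (g := g)
    (Eventually.of_forall fun t => contDiff_re_ofReal (hΦd t)) ?_ ?_
  · -- same real zeros: `c_t ≠ 0` and `F t x` is real
    filter_upwards [hC] with t ht
    have : {x : ℝ | 0 < x ∧ x ≤ T ∧ g t x = 0} = {x : ℝ | 0 < x ∧ x ≤ T ∧ F t x = 0} := by
      ext x
      simp only [mem_setOf_eq, g, Φ, Complex.re_ofReal_mul, mul_eq_zero, hc t, false_or]
      constructor
      · rintro ⟨h0, hT, h⟩
        exact ⟨h0, hT, Complex.ext (by simpa using h) (by simpa using hreal t x)⟩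
      · rintro ⟨h0, hT, h⟩
        exact ⟨h0, hT, by simp [h]⟩
    rw [this]; exact ht
  · intro k _
    have := tendstoUniformlyOn_re_iteratedDeriv hUo hΦd hloc hseg k
    rw [iteratedDeriv_re_ofReal differentiable_riemannXiUpper']
    refine this.congr (Eventually.of_forall fun t x _ => ?_)
    change (iteratedDeriv k (Φ t) x).re = iteratedDeriv k (g t) x
    rw [hg, iteratedDeriv_re_ofReal (hΦd t)]

/-- **Per window, in the tree's words.** Under the hypotheses of `im_eq_zero_of_count_of_nhds`:
`RiemannHypothesisInStripUpTo T` — every zero of `ζ` in the critical strip with `|Im ρ| ≤ T` lies on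
the critical line. For `T ≤ 3·10¹²` this conclusion is certified knowledge (Platt–Trudgian); the content
of SC-2 ∧ SC-3 is their uniformity in `T`. -/
theorem riemannHypothesisInStripUpTo_of_count_of_nhds {F : ℝ → ℂ → ℂ}
    (hdiff : ∀ t, Differentiable ℂ (F t)) (hreal : ∀ (t : ℝ) (x : ℝ), (F t x).im = 0)
    {c : ℝ → ℝ} (hc : ∀ t, c t ≠ 0) {T : ℝ} {U : Set ℂ} (hUo : IsOpen U)
    (hseg : ∀ x ∈ Icc (0 : ℝ) T, (x : ℂ) ∈ U)
    (hC : ∀ᶠ t : ℝ in atTop,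
      {x : ℝ | 0 < x ∧ x ≤ T ∧ F t x = 0}.encard = (zetaZeroCount T : ℕ∞))
    (hloc : TendstoLocallyUniformlyOn (fun t z => ((c t : ℝ) : ℂ) * F t z) riemannXiUpper atTop U) :
    RiemannHypothesisInStripUpTo T := by
  have key := im_eq_zero_of_count_of_nhds hdiff hreal hc hUo hseg hC hloc
  intro ρ hζ h0 h1 hT
  set z : ℂ := -I * (ρ - 1 / 2) with hz
  have hρ : (1 / 2 : ℂ) + I * z = ρ := by
    have : I * I = -1 := Complex.I_mul_I
    simp only [z]; linear_combination (-(ρ - 1 / 2)) * this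
  have hΞ : riemannXiUpper z = 0 := by
    rw [riemannXiUpper, hρ]; exact (riemannXi_eq_zero_iff_holds ρ).mpr ⟨hζ, h0, h1⟩
  have hzre : z.re = ρ.im := by simp [z]
  have hzim : z.im = 1 / 2 - ρ.re := by simp [z]
  rcases lt_trichotomy ρ.im 0 with him | him | him
  · have hΞ' : riemannXiUpper (-z) = 0 := by rw [riemannXiUpper_neg]; exact hΞ
    have h := key (-z) hΞ' (by simp [hzre]; linarith) (by
      simp only [neg_re, hzre]; rw [abs_of_neg him] at hT; exact hT)
    simp only [neg_im, hzim] at h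
    linarith
  · exact absurd hζ (riemannZeta_ne_zero_of_im_eq_zero_of_pos_of_lt_one him h0 h1)
  · have h := key z hΞ (by rw [hzre]; exact him) (by rw [hzre]; rw [abs_of_pos him] at hT; exact hT)
    rw [hzim] at h
    linarith

/-- **G22-T, open-neighbourhood form.** `û_t` entire and real on `ℝ`, normalisers `c_t ≠ 0`; SC-2 at
unboundedly many heights `T`; for every `T > 0` an open `U ⊇ [0, T]` with `c_t û_t → Ξ` locally
uniformly on `U`. Then `RiemannHypothesis`. -/
theorem riemannHypothesis_of_frequently_count_of_nhds {F : ℝ → ℂ → ℂ}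
    (hdiff : ∀ t, Differentiable ℂ (F t)) (hreal : ∀ (t : ℝ) (x : ℝ), (F t x).im = 0)
    {c : ℝ → ℝ} (hc : ∀ t, c t ≠ 0)
    (hC : ∃ᶠ T : ℝ in atTop, ∀ᶠ t : ℝ in atTop,
      {x : ℝ | 0 < x ∧ x ≤ T ∧ F t x = 0}.encard = (zetaZeroCount T : ℕ∞))
    (hconv : ∀ T : ℝ, 0 < T → ∃ U : Set ℂ, IsOpen U ∧ (∀ x ∈ Icc (0 : ℝ) T, (x : ℂ) ∈ U) ∧
      TendstoLocallyUniformlyOn (fun t z => ((c t : ℝ) : ℂ) * F t z) riemannXiUpper atTop U) :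
    RiemannHypothesis := by
  have key : ∀ R : ℝ, ∀ z : ℂ, riemannXiUpper z = 0 → 0 < z.re → z.re ≤ R → z.im = 0 := by
    intro R z hz hz0 hzR
    obtain ⟨T, hTR, hCT⟩ := (hC.and_eventually (eventually_ge_atTop (max R 1))).exists
    have hT0 : 0 < T := lt_of_lt_of_le one_pos ((le_max_right _ _).trans hCT)
    obtain ⟨U, hUo, hseg, hloc⟩ := hconv T hT0
    exact im_eq_zero_of_count_of_nhds hdiff hreal hc hUo hseg hTR hloc z hz hz0
      (hzR.trans ((le_max_left _ _).trans hCT))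
  refine (riemannHypothesis_iff_im_eq_zero_of_riemannXiUpper_eq_zero_holds :
    RiemannHypothesis ↔ _).mpr fun z hz => ?_
  rcases lt_trichotomy z.re 0 with hre | hre | hre
  · have hz' : riemannXiUpper (-z) = 0 := by rw [riemannXiUpper_neg]; exact hz
    have := key ((-z).re) (-z) hz' (by simp; linarith) le_rfl
    simpa using this
  · exact absurd hre (re_ne_zero_of_riemannXiUpper_eq_zero hz)
  · exact key z.re z hz hre le_rfl

/-! ## From idea-3's thin rectangles (even families) to a neighbourhood of the segment -/

/-- For an EVEN family converging to (the even) `Ξ` uniformly on the thin rectangle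
`[0, T'] × [-δ, δ]`, convergence holds locally uniformly on the open symmetric rectangle
`(-T', T') × (-δ, δ)`, a neighbourhood of every real segment `[0, T]` with `T < T'`. -/
theorem exists_nhds_of_even_thinRect {Φ : ℝ → ℂ → ℂ} (heven : ∀ t z, Φ t (-z) = Φ t z)
    {T T' δ : ℝ} (hTT' : T < T') (hT : 0 ≤ T) (hδ : 0 < δ)
    (h : TendstoUniformlyOn Φ riemannXiUpper atTop (Icc 0 T' ×ℂ Icc (-δ) δ)) :
    ∃ U : Set ℂ, IsOpen U ∧ (∀ x ∈ Icc (0 : ℝ) T, (x : ℂ) ∈ U) ∧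
      TendstoLocallyUniformlyOn Φ riemannXiUpper atTop U := by
  set R : Set ℂ := Icc 0 T' ×ℂ Icc (-δ) δ with hR
  refine ⟨Ioo (-T') T' ×ℂ Ioo (-δ) δ, isOpen_Ioo.reProdIm isOpen_Ioo, fun x hx =>
    mem_reProdIm.mpr ⟨⟨by simp; linarith [hx.1], by simp; linarith [hx.2]⟩, by simp [hδ], by simp [hδ]⟩,
    ?_⟩
  have h' : TendstoUniformlyOn Φ riemannXiUpper atTop ((fun z : ℂ => -z) ⁻¹' R) := by
    have := h.comp (fun z : ℂ => -z)
    have hΦ : (fun t => Φ t ∘ fun z : ℂ => -z) = Φ := by funext t z; simp [heven]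
    have hΞ : (riemannXiUpper ∘ fun z : ℂ => -z) = riemannXiUpper := by
      funext z; simp [riemannXiUpper_neg]
    rwa [hΦ, hΞ] at this
  have hU : TendstoUniformlyOn Φ riemannXiUpper atTop (R ∪ (fun z : ℂ => -z) ⁻¹' R) := by
    intro u hu
    filter_upwards [h u hu, h' u hu] with n hn hn' x hx
    exact hx.elim (hn x) (hn' x)
  refine (hU.mono ?_).tendstoLocallyUniformlyOn
  intro z hz
  obtain ⟨⟨hr1, hr2⟩, hi1, hi2⟩ := mem_reProdIm.mp hz
  rcases le_or_gt 0 z.re with hre | hre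
  · exact Or.inl (mem_reProdIm.mpr ⟨⟨hre, hr2.le⟩, hi1.le, hi2.le⟩)
  · exact Or.inr (mem_reProdIm.mpr
      ⟨⟨by simp; exact hre.le, by simp; linarith⟩, by simp; linarith, by simp; linarith⟩)

/-- **G22-T, thin-rectangle form with SC-2 at unboundedly many heights** (cf.
`riemannHypothesis_of_count_of_thin`): entire, real-on-`ℝ`, even `û_t`; SC-2 frequently in `T`;
SC-3 with `δ > 0` and normalisers `e^{-α_t}` on every `[0, T] × [-δ, δ]`. Then `RiemannHypothesis`. -/
theorem riemannHypothesis_of_frequently_count_of_thin {F : ℝ → ℂ → ℂ}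
    (hdiff : ∀ t, Differentiable ℂ (F t)) (hreal : ∀ (t : ℝ) (x : ℝ), (F t x).im = 0)
    (heven : ∀ (t : ℝ) (z : ℂ), F t (-z) = F t z)
    (hC : ∃ᶠ T : ℝ in atTop, ∀ᶠ t : ℝ in atTop,
      {x : ℝ | 0 < x ∧ x ≤ T ∧ F t x = 0}.encard = (zetaZeroCount T : ℕ∞))
    (hT : ∃ δ : ℝ, 0 < δ ∧ ∃ α : ℝ → ℝ, ∀ T : ℝ, 0 < T →
      TendstoUniformlyOn (fun t z => ((Real.exp (-α t) : ℝ) : ℂ) * F t z) riemannXiUpper atTop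
        (Icc 0 T ×ℂ Icc (-δ) δ)) :
    RiemannHypothesis := by
  obtain ⟨δ, hδ, α, hconv⟩ := hT
  refine riemannHypothesis_of_frequently_count_of_nhds hdiff hreal (c := fun t => Real.exp (-α t))
    (fun t => (Real.exp_pos _).ne') hC fun T hT0 => ?_
  exact exists_nhds_of_even_thinRect (Φ := fun t z => ((Real.exp (-α t) : ℝ) : ℂ) * F t z)
    (fun t z => by simp [heven t z]) (lt_add_one T) hT0.le hδ (hconv (T + 1) (by linarith))

/-! ## The intended instance: real even Weil ground states -/

/-- A real-valued even function is self-adjoint in Bombieri's sense: `conj (u (-x)) = u x`. -/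
theorem selfAdjoint_of_real_even {u : ℝ → ℂ} (hre : ∀ x, (u x).im = 0) (hev : ∀ x, u (-x) = u x)
    (x : ℝ) : conj (u (-x)) = u x := by
  rw [hev x]
  exact Complex.conj_eq_iff_im.mpr (hre x)

/-- For real even `u`, the transform `x ↦ û(1/2 + ix)` is real on `ℝ`. -/
theorem im_weilMellin_eq_zero_of_real_even {u : ℝ → ℂ} (hre : ∀ x, (u x).im = 0)
    (hev : ∀ x, u (-x) = u x) (x : ℝ) : (weilMellin u (1 / 2 + I * x)).im = 0 := by
  have h := conj_weilMellin_of_selfAdjoint (selfAdjoint_of_real_even hre hev) (1 / 2 + I * x)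
  have hs : 1 - conj ((1 : ℂ) / 2 + I * x) = 1 / 2 + I * x := by
    simp only [map_add, map_div₀, map_one, map_ofNat, map_mul, Complex.conj_I, Complex.conj_ofReal]
    ring
  rw [hs] at h
  exact Complex.conj_eq_iff_im.mp h

/-- For real even `u`, the transform `z ↦ û(1/2 + iz)` is even. -/
theorem weilMellin_neg_of_real_even {u : ℝ → ℂ} (hre : ∀ x, (u x).im = 0)
    (hev : ∀ x, u (-x) = u x) (z : ℂ) :
    weilMellin u (1 / 2 + I * (-z)) = weilMellin u (1 / 2 + I * z) := by
  have hreal_fun : (fun x => conj (u x)) = u := by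
    funext x; exact Complex.conj_eq_iff_im.mpr (hre x)
  have hconj : ∀ w : ℂ, weilMellin u (conj w) = conj (weilMellin u w) := by
    intro w
    have := weilMellin_conj u (conj w)
    rw [hreal_fun, Complex.conj_conj] at this
    exact this
  have hsa := conj_weilMellin_of_selfAdjoint (selfAdjoint_of_real_even hre hev)
  have h1 : (1 : ℂ) / 2 + I * (-z) = conj (1 / 2 + I * conj z) := by
    simp only [map_add, map_div₀, map_one, map_ofNat, map_mul, Complex.conj_I, Complex.conj_conj]
    ring
  rw [h1, hconj, hsa]
  congr 1
  simp only [map_add, map_div₀, map_one, map_ofNat, map_mul, Complex.conj_I, Complex.conj_conj]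
  ring

/-- **G22-T for the Weil ground states.** Windows `a_t`, REAL EVEN ground states `u_t`
(`IsWeilGroundState (a t) (u t)`), `û_t(z) := 𝓜u_t(1/2 + iz)`. SC-2 at unboundedly many heights
(`∃ᶠ T`, eventually `#{x ∈ (0, T] : û_t(x) = 0} = N(T)`) and SC-3 (`δ > 0`, normalisers `e^{-α_t}`,
uniform convergence to `Ξ` on every `[0, T] × [-δ, δ]`) imply the Riemann Hypothesis. (`û_t` is
entire by `IsWeilGroundState.differentiable_weilMellin`, real on `ℝ` and even by the two lemmas
above.) Nothing here is, or suggests, a proof of RH. -/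
theorem riemannHypothesis_of_groundStates_count_thin {a : ℝ → ℝ} {u : ℝ → ℝ → ℂ}
    (hu : ∀ t, IsWeilGroundState (a t) (u t)) (hre : ∀ (t : ℝ) (x : ℝ), (u t x).im = 0)
    (hev : ∀ (t : ℝ) (x : ℝ), u t (-x) = u t x)
    (hC : ∃ᶠ T : ℝ in atTop, ∀ᶠ t : ℝ in atTop,
      {x : ℝ | 0 < x ∧ x ≤ T ∧ weilMellin (u t) (1 / 2 + I * x) = 0}.encard = (zetaZeroCount T : ℕ∞))
    (hT : ∃ δ : ℝ, 0 < δ ∧ ∃ α : ℝ → ℝ, ∀ T : ℝ, 0 < T →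
      TendstoUniformlyOn (fun t z => ((Real.exp (-α t) : ℝ) : ℂ) * weilMellin (u t) (1 / 2 + I * z))
        riemannXiUpper atTop (Icc 0 T ×ℂ Icc (-δ) δ)) :
    RiemannHypothesis :=
  riemannHypothesis_of_frequently_count_of_thin (F := fun t z => weilMellin (u t) (1 / 2 + I * z))
    (fun t => (hu t).differentiable_weilMellin.comp
      (((differentiable_const _).mul differentiable_id).const_add _))
    (fun t x => im_weilMellin_eq_zero_of_real_even (hre t) (hev t) x)
    (fun t z => weilMellin_neg_of_real_even (hre t) (hev t) z) hC hT

/-! Axiom census (expected `propext`, `Classical.choice`, `Quot.sound`). -/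
#print axioms riemannHypothesis_of_frequently_count_of_nhds
#print axioms riemannHypothesis_of_groundStates_count_thin

end CountThin

end Summit.RiemannHypothesis.RiemannHypothesis.Theorems

end
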